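import Mathlib
import HarnessLib
import Literature.Analysis.FluidPDE.VorticityEquation
import Literature.Analysis.FluidPDE.NSLocalLerayBackwardUniqueness
import Literature.Analysis.FluidPDE.BarkerPrange2020VorticityAlignmentTypeIHolds
import Summits.NavierStokesRegularity.NavierStokesRegularity.Theorems.PoloidalWindowDoorPoloidalWindowRigidityWindow
import Summits.NavierStokesRegularity.NavierStokesRegularity.Theorems.AxisTwistDoorTiltDominationLocEnergyClass

/-!
# AxisTwistDoor · crux `TiltDominationLoc` (stmt-NavierStokesRegularity-26991) — ONE-SIGNED POLOIDAL-SLICE RIGIDITY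
# (the first stratum of W3 that USES the sign `ω₃ ≥ 0`: a poloidal slice of a one-signed profile carries no vertical
# vortex stretching)

Crux 26991 in core form (`…EnergyClass.oneSignedRigidity_iff_core`): no Type-I ancient Oseen-mild profile with
`ω₃ = ⟪curl v, e₃⟫ ≥ 0` on the backward slab is backward-singular at the apex.  Portrait II
(`…SymmetryExclusions`, p646656) showed, sign-free, that a profile whose vorticity is VERTICAL on one slice is not a
counterexample.  The opposite extreme on one slice — the vorticity HORIZONTAL there, `ω₃(s₀, ·) ≡ 0` (a «poloidal
slice») — is where the one-signed crux meets wall W4 (19708).  Here the SIGN gives a rigidity statement on such a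
slice, elementary but new in the tree:

* `omega3_slice_eq_zero_of_eqOn_open` — (analyticity, sign-free) if `ω₃(s₀,·)` vanishes on a non-empty open set of
  ONE slice `s₀ < 0`, it vanishes on the whole slice (slices of the class are real-analytic; g3's
  `…Rigidity.analyticOnNhd_omega3`);
* `hasDerivAt_omega3_zero_of_poloidalSlice` — (SIGN) if moreover `ω₃ ≥ 0` on the slab, then `t ↦ ω₃(t,y)` has a
  temporal minimum at `s₀` for every `y`, so `∂ₜω₃(s₀, y) = 0` (Fermat);
* `vertical_stretching_eq_zero_of_poloidalSlice` — (SIGN + vorticity equation) hence the vertical component of the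
  vortex-stretching vector vanishes identically on that slice: `⟪(∇v(s₀,y)) ω(s₀,y), e₃⟫ = 0` for all `y` — the third
  component of `∂ₜω + (v·∇)ω = (ω·∇)v + Δω` at `s₀`, where `∂ₜω₃ = 0` (temporal minimum), `(v·∇)ω₃ = 0` and
  `Δω₃ = 0` (the slice function `ω₃(s₀,·)` is identically zero).  In coordinates: `ω₁∂₁v₃ + ω₂∂₂v₃ ≡ 0`, i.e.
  `∂₃v_h ∥ ∇_h v₃` on the slice — the (TH) structure of the K2 lineage (`Cruxes/PoloidalWindowRigidity/
  POLY-SECTOR-K2p5.md` §1), which for POLOIDAL profiles (ω₃ ≡ 0 at all times) holds at every time for the trivial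
  reason `∂ₜω₃ ≡ 0`; the point here is that ONE poloidal slice of a ONE-SIGNED profile is already (TH);
* `poloidalSlice_rigidity` — the package.

So along W3 the one-signed counterexample, read on any single slice, is: nowhere-vertical on a dense open set
(portrait II), and wherever it is fully horizontal on an open set, the whole slice is horizontal AND stretching-free
in the vertical direction.  WHAT THIS IS NOT: no claim that a poloidal slice forces a poloidal profile (that would be
W6 ∧ more); nothing here proves 26991, W4, W6, the leaf or any Navier–Stokes regularity statement (Clay A OPEN).
Seat ns-atd-p1 (LEAD g4).  [cite: MajdaBertozzi2002, §1.4 eq. (1.33) (vorticity equation); LemarieRieusset2016,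
Thm. 9.12 (analyticity of bounded mild solutions)]
-/

noncomputable section

-- the summit and its single sub-problem share the name (CONVENTIONS §1), as in every Theorems file
set_option linter.dupNamespace false

namespace Summit.NavierStokesRegularity.NavierStokesRegularity.Theorems.AxisTwistDoorTiltDominationLocPoloidalSlice

open Set Function Filter Topology MeasureTheory Metric
open scoped ENNReal InnerProductSpace
open Literature.Analysis Literature.Analysis.FluidPDE
open Summit.NavierStokesRegularity.NavierStokesRegularity.Theorems.PoloidalWindowDoorPoloidalWindowRigidityWindow
  (isTypeIAncientMild_of_class)
open Summit.NavierStokesRegularity.NavierStokesRegularity.Theorems.AxisTwistDoorTiltDominationLocRigidity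
  (analyticOnNhd_omega3)

variable {C : ℝ} {v : ℝ → EuclideanSpace ℝ (Fin 3) → EuclideanSpace ℝ (Fin 3)}

/-- Slices of a jointly analytic function on the open backward slab are analytic (plumbing). -/
private theorem analyticAt_slice_of_joint {X : Type*} [NormedAddCommGroup X] [NormedSpace ℝ X]
    {F : ℝ × EuclideanSpace ℝ (Fin 3) → X} (hF : AnalyticOnNhd ℝ F (Iio (0 : ℝ) ×ˢ univ))
    {s₀ : ℝ} (hs₀ : s₀ < 0) (y : EuclideanSpace ℝ (Fin 3)) :
    AnalyticAt ℝ (fun z : EuclideanSpace ℝ (Fin 3) => F (s₀, z)) y :=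
  AnalyticAt.comp₂ (h := F) (f := fun _ : EuclideanSpace ℝ (Fin 3) => s₀) (g := fun z : EuclideanSpace ℝ (Fin 3) => z)
    (hF (s₀, y) ⟨hs₀, mem_univ _⟩) analyticAt_const analyticAt_id

/-- Time lines of a jointly analytic function on the open backward slab are analytic at interior times (plumbing). -/
private theorem analyticAt_line_of_joint {X : Type*} [NormedAddCommGroup X] [NormedSpace ℝ X]
    {F : ℝ × EuclideanSpace ℝ (Fin 3) → X} (hF : AnalyticOnNhd ℝ F (Iio (0 : ℝ) ×ˢ univ))
    {s₀ : ℝ} (hs₀ : s₀ < 0) (y : EuclideanSpace ℝ (Fin 3)) :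
    AnalyticAt ℝ (fun t : ℝ => F (t, y)) s₀ :=
  AnalyticAt.comp₂ (h := F) (f := fun t : ℝ => t) (g := fun _ : ℝ => y)
    (hF (s₀, y) ⟨hs₀, mem_univ _⟩) analyticAt_id analyticAt_const

/-! ### §1 Analyticity: `ω₃` vanishing on an open subset of a slice vanishes on the slice -/

/-- **A slice of `ω₃` vanishing on a non-empty open set vanishes identically** (sign-free): the slice
`y ↦ ⟪curl v(s₀) y, e₃⟫` of a class profile is real-analytic on the connected `ℝ³` (joint analyticity
`…Rigidity.analyticOnNhd_omega3` composed with `y ↦ (s₀, y)`), so the identity theorem applies. [cite: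
LemarieRieusset2016, Thm. 9.12 (PDF p. 260)] -/
theorem omega3_slice_eq_zero_of_eqOn_open (hrate : HasTypeITimeDecay C v)
    (hcont : ContinuousOn (uncurry v) (Iio (0 : ℝ) ×ˢ univ))
    (hmild : ∀ s t : ℝ, s < t → t < 0 → ∀ x,
      v t x = UnboundedOperators.heatExtension (v s) (t - s) x - oseenDuhamel 1 s v v t x)
    {s₀ : ℝ} (hs₀ : s₀ < 0) {O : Set (EuclideanSpace ℝ (Fin 3))} (hO : IsOpen O) (hne : O.Nonempty)
    (hzero : ∀ y ∈ O, ⟪curl (v s₀) y, (EuclideanSpace.single (2 : Fin 3) (1 : ℝ))⟫_ℝ = 0) :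
    ∀ y, ⟪curl (v s₀) y, (EuclideanSpace.single (2 : Fin 3) (1 : ℝ))⟫_ℝ = 0 := by
  have hF := analyticOnNhd_omega3 hrate hcont hmild
  -- the slice is analytic on `univ`
  have hslice : AnalyticOnNhd ℝ (fun y : EuclideanSpace ℝ (Fin 3) =>
      ⟪curl (v s₀) y, (EuclideanSpace.single (2 : Fin 3) (1 : ℝ))⟫_ℝ) univ := by
    intro y _
    exact analyticAt_slice_of_joint hF hs₀ y
  obtain ⟨y₀, hy₀⟩ := hne
  have h0 : (fun y : EuclideanSpace ℝ (Fin 3) =>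
      ⟪curl (v s₀) y, (EuclideanSpace.single (2 : Fin 3) (1 : ℝ))⟫_ℝ) =ᶠ[𝓝 y₀] 0 := by
    filter_upwards [hO.mem_nhds hy₀] with y hy
    exact hzero y hy
  have hz := hslice.eqOn_zero_of_preconnected_of_eventuallyEq_zero isPreconnected_univ (mem_univ y₀) h0
  intro y
  exact hz (mem_univ y)

/-! ### §2 The sign: a poloidal slice of a one-signed profile is a temporal minimum of `ω₃` -/

/-- **Fermat on a poloidal slice** (uses the SIGN): if `ω₃ ≥ 0` on the backward slab and `ω₃(s₀, ·) ≡ 0` on a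
non-empty open set of one slice `s₀ < 0`, then for every `y` the time line `t ↦ ω₃(t, y)` (differentiable at `s₀`, by
joint analyticity) has a minimum at the interior time `s₀`, hence derivative `0` there:
`HasDerivAt (t ↦ ⟪curl v(t) y, e₃⟫) 0 s₀`. [cite: LemarieRieusset2016, Thm. 9.12 (analyticity, for differentiability
in time)] -/
theorem hasDerivAt_omega3_zero_of_poloidalSlice (hrate : HasTypeITimeDecay C v)
    (hcont : ContinuousOn (uncurry v) (Iio (0 : ℝ) ×ˢ univ))
    (hmild : ∀ s t : ℝ, s < t → t < 0 → ∀ x,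
      v t x = UnboundedOperators.heatExtension (v s) (t - s) x - oseenDuhamel 1 s v v t x)
    (hnn : ∀ s < (0 : ℝ), ∀ y, 0 ≤ ⟪curl (v s) y, (EuclideanSpace.single (2 : Fin 3) (1 : ℝ))⟫_ℝ)
    {s₀ : ℝ} (hs₀ : s₀ < 0) {O : Set (EuclideanSpace ℝ (Fin 3))} (hO : IsOpen O) (hne : O.Nonempty)
    (hzero : ∀ y ∈ O, ⟪curl (v s₀) y, (EuclideanSpace.single (2 : Fin 3) (1 : ℝ))⟫_ℝ = 0) (y : EuclideanSpace ℝ (Fin 3)) :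
    HasDerivAt (fun t : ℝ => ⟪curl (v t) y, (EuclideanSpace.single (2 : Fin 3) (1 : ℝ))⟫_ℝ) 0 s₀ := by
  have hall := omega3_slice_eq_zero_of_eqOn_open hrate hcont hmild hs₀ hO hne hzero
  have hF := analyticOnNhd_omega3 hrate hcont hmild
  -- differentiability of the time line at `s₀`
  have hline : AnalyticAt ℝ (fun t : ℝ => ⟪curl (v t) y, (EuclideanSpace.single (2 : Fin 3) (1 : ℝ))⟫_ℝ) s₀ := by
    exact analyticAt_line_of_joint hF hs₀ y
  have hd : HasDerivAt (fun t : ℝ => ⟪curl (v t) y, (EuclideanSpace.single (2 : Fin 3) (1 : ℝ))⟫_ℝ)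
      (deriv (fun t : ℝ => ⟪curl (v t) y, (EuclideanSpace.single (2 : Fin 3) (1 : ℝ))⟫_ℝ) s₀) s₀ :=
    hline.differentiableAt.hasDerivAt
  -- `s₀` is a (local) minimum of the time line: `ω₃ ≥ 0` near `s₀ < 0` and `ω₃(s₀, y) = 0`
  have hmin : IsLocalMin (fun t : ℝ => ⟪curl (v t) y, (EuclideanSpace.single (2 : Fin 3) (1 : ℝ))⟫_ℝ) s₀ := by
    filter_upwards [Iio_mem_nhds hs₀] with t ht
    rw [hall y]
    exact hnn t ht y
  have h0 := hmin.hasDerivAt_eq_zero hd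
  rwa [h0] at hd

/-! ### §3 The vorticity equation: no vertical vortex stretching on a poloidal slice -/

/-- **No vertical vortex stretching on a poloidal slice of a one-signed profile.**  Class profile, `ω₃ ≥ 0` on the
slab, `ω₃(s₀,·) = 0` on a non-empty open set of one slice `s₀ < 0`.  Then for every `y`:
`⟪(fderiv ℝ (v s₀) y) (curl v(s₀) y), e₃⟫ = 0`, i.e. `ω₁∂₁v₃ + ω₂∂₂v₃ = 0` on the slice (`ω₃ = 0` there).  Proof: the
third component of the vorticity equation `∂ₜω + (v·∇)ω = (ω·∇)v + Δω` (classical on `(−∞,0)`: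
`exists_classical_of_class`, `isVorticitySolutionOn_zero_force`) at `(s₀, y)`: `∂ₜω₃ = 0` by §2, `(v·∇)ω₃ = 0` and
`Δω₃ = 0` because the slice function `ω₃(s₀,·)` vanishes identically (§1). [cite: MajdaBertozzi2002, §1.4 eq. (1.33)
and Prop. 2.21 (vorticity equation)] -/
theorem vertical_stretching_eq_zero_of_poloidalSlice (hrate : HasTypeITimeDecay C v)
    (hcont : ContinuousOn (uncurry v) (Iio (0 : ℝ) ×ˢ univ))
    (hmild : ∀ s t : ℝ, s < t → t < 0 → ∀ x,
      v t x = UnboundedOperators.heatExtension (v s) (t - s) x - oseenDuhamel 1 s v v t x)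
    (hdiv : ∀ t < 0, VectorCalculus.IsDivFree (v t))
    (hnn : ∀ s < (0 : ℝ), ∀ y, 0 ≤ ⟪curl (v s) y, (EuclideanSpace.single (2 : Fin 3) (1 : ℝ))⟫_ℝ)
    {s₀ : ℝ} (hs₀ : s₀ < 0) {O : Set (EuclideanSpace ℝ (Fin 3))} (hO : IsOpen O) (hne : O.Nonempty)
    (hzero : ∀ y ∈ O, ⟪curl (v s₀) y, (EuclideanSpace.single (2 : Fin 3) (1 : ℝ))⟫_ℝ = 0) (y : EuclideanSpace ℝ (Fin 3)) :
    ⟪(fderiv ℝ (v s₀) y) (curl (v s₀) y), (EuclideanSpace.single (2 : Fin 3) (1 : ℝ))⟫_ℝ = 0 := by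
  set e : EuclideanSpace ℝ (Fin 3) := EuclideanSpace.single (2 : Fin 3) (1 : ℝ) with he
  set L : EuclideanSpace ℝ (Fin 3) →L[ℝ] ℝ := innerSL ℝ e with hL
  have hLapp : ∀ w : EuclideanSpace ℝ (Fin 3), L w = ⟪w, e⟫_ℝ := fun w => by
    rw [hL, innerSL_apply_apply, real_inner_comm]
  have hall := omega3_slice_eq_zero_of_eqOn_open hrate hcont hmild hs₀ hO hne hzero
  have hU := isTypeIAncientMild_of_class hrate hcont hmild hdiv
  -- the vorticity equation at `(s₀, y)`
  obtain ⟨q, hcl⟩ := ChiralWindowDoorClassDerivDecay.exists_classical_of_class hrate hcont hmild hdiv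
  have hvort := hcl.isVorticitySolutionOn_zero_force (uniqueDiffOn_Iio 0)
    (by rw [interior_Iio]; exact subset_closure)
  have heq := hvort.vorticity_eq s₀ hs₀ y
  simp only [vorticity_apply, one_smul] at heq
  -- (i) the time derivative term pairs to `0` with `e₃`
  have hline := hasDerivAt_omega3_zero_of_poloidalSlice hrate hcont hmild hnn hs₀ hO hne hzero y
  have hFω : AnalyticOnNhd ℝ (uncurry fun t x => curl (v t) x) (Iio (0 : ℝ) ×ˢ univ) :=
    TubeAlternative.AnalyticPropagation.analyticOnNhd_uncurry_curl
      (LocalSineTubeDoorProfileAlignedWindowRigidityAncient.analyticOnNhd_uncurry hcont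
        (LocalSineTubeDoorProfileAlignedWindowRigidityAncient.bdd_of_hasTypeITimeDecay hrate) hmild) isOpen_Iio
  have hgline : DifferentiableAt ℝ (fun t : ℝ => curl (v t) y) s₀ := by
    exact (analyticAt_line_of_joint hFω hs₀ y).differentiableAt
  have h1 : ⟪timeDerivWithin (Iio (0 : ℝ)) (vorticity v) s₀ y, e⟫_ℝ = 0 := by
    rw [timeDerivWithin_apply, derivWithin_of_isOpen isOpen_Iio hs₀]
    show ⟪deriv (fun t : ℝ => curl (v t) y) s₀, e⟫_ℝ = 0
    have hcomp : HasDerivAt (fun t : ℝ => L (curl (v t) y)) (L (deriv (fun t : ℝ => curl (v t) y) s₀)) s₀ :=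
      L.hasFDerivAt.comp_hasDerivAt s₀ hgline.hasDerivAt
    have hcomp' : HasDerivAt (fun t : ℝ => ⟪curl (v t) y, e⟫_ℝ) (L (deriv (fun t : ℝ => curl (v t) y) s₀)) s₀ := by
      have hfun : (fun t : ℝ => L (curl (v t) y)) = fun t : ℝ => ⟪curl (v t) y, e⟫_ℝ := funext fun t => hLapp _
      rw [← hfun]
      exact hcomp
    rw [← hLapp, ← hcomp'.unique hline]
  -- (ii) the convection term `(v·∇)ω` pairs to `0` with `e₃`: the slice function `ω₃(s₀,·) ≡ 0`
  have hcurl_an : AnalyticOnNhd ℝ (curl (v s₀)) univ := analyticOnNhd_curl (hU.analyticOnNhd_slice_univ hs₀)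
  have hcurl_diff : DifferentiableAt ℝ (curl (v s₀)) y := (hcurl_an y (mem_univ y)).differentiableAt
  have h2 : ⟪convect (v s₀) (curl (v s₀)) y, e⟫_ℝ = 0 := by
    rw [convect_apply, ← hLapp]
    have hcomp : HasFDerivAt (fun z => L (curl (v s₀) z)) (L.comp (fderiv ℝ (curl (v s₀)) y)) y :=
      L.hasFDerivAt.comp y hcurl_diff.hasFDerivAt
    have hzeroFun : (fun z => L (curl (v s₀) z)) = fun _ => (0 : ℝ) := by
      funext z
      rw [hLapp, hall z]
    rw [hzeroFun] at hcomp
    have huniq : L.comp (fderiv ℝ (curl (v s₀)) y) = 0 :=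
      hcomp.unique (hasFDerivAt_const (0 : ℝ) y)
    have := congrArg (fun φ : EuclideanSpace ℝ (Fin 3) →L[ℝ] ℝ => φ (v s₀ y)) huniq
    simpa using this
  -- (iii) the Laplacian term pairs to `0` with `e₃`
  have h3 : ⟪Laplacian.laplacian (curl (v s₀)) y, e⟫_ℝ = 0 := by
    rw [← hLapp]
    have hc2 : ContDiffAt ℝ 2 (curl (v s₀)) y := (hcurl_an y (mem_univ y)).contDiffAt
    have key := hc2.laplacian_CLM_comp_left (l := L)
    have hzeroFun : (⇑L ∘ curl (v s₀)) = fun _ => (0 : ℝ) := by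
      funext z
      simp only [Function.comp_apply]
      rw [hLapp, hall z]
    rw [hzeroFun, InnerProductSpace.laplacian_const] at key
    simpa using key.symm
  -- assemble: pair the vorticity equation with `e₃`
  have hpair := congrArg (fun w : EuclideanSpace ℝ (Fin 3) => ⟪w, e⟫_ℝ) heq
  simp only [inner_add_left] at hpair
  rw [h1, h2, h3, zero_add, add_zero] at hpair
  -- `hpair : 0 = ⟪convect (curl (v s₀)) (v s₀) y, e⟫`
  rw [convect_apply] at hpair
  exact hpair.symm

/-! ### §4 Package -/

/-- **ONE-SIGNED POLOIDAL-SLICE RIGIDITY.**  For a profile of the route's class with `ω₃ ≥ 0` on the backward slab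
whose vertical vorticity vanishes on a non-empty open subset of ONE slice `s₀ < 0`: (a) `ω₃(s₀,·) ≡ 0` on `ℝ³`;
(b) `∂ₜω₃(s₀,·) ≡ 0`; (c) no vertical vortex stretching on the slice, `⟪(∇v(s₀,y)) ω(s₀,y), e₃⟫ = 0` for all `y`
(the slice is (TH) in the K2 lineage's sense).  Sign-using, elementary; it does NOT say the profile is poloidal. [cite:
MajdaBertozzi2002, §1.4 eq. (1.33) (vorticity equation)] -/
theorem poloidalSlice_rigidity (hrate : HasTypeITimeDecay C v)
    (hcont : ContinuousOn (uncurry v) (Iio (0 : ℝ) ×ˢ univ))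
    (hmild : ∀ s t : ℝ, s < t → t < 0 → ∀ x,
      v t x = UnboundedOperators.heatExtension (v s) (t - s) x - oseenDuhamel 1 s v v t x)
    (hdiv : ∀ t < 0, VectorCalculus.IsDivFree (v t))
    (hnn : ∀ s < (0 : ℝ), ∀ y, 0 ≤ ⟪curl (v s) y, (EuclideanSpace.single (2 : Fin 3) (1 : ℝ))⟫_ℝ)
    {s₀ : ℝ} (hs₀ : s₀ < 0) {O : Set (EuclideanSpace ℝ (Fin 3))} (hO : IsOpen O) (hne : O.Nonempty)
    (hzero : ∀ y ∈ O, ⟪curl (v s₀) y, (EuclideanSpace.single (2 : Fin 3) (1 : ℝ))⟫_ℝ = 0) :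
    (∀ y, ⟪curl (v s₀) y, (EuclideanSpace.single (2 : Fin 3) (1 : ℝ))⟫_ℝ = 0) ∧
      (∀ y, HasDerivAt (fun t : ℝ => ⟪curl (v t) y, (EuclideanSpace.single (2 : Fin 3) (1 : ℝ))⟫_ℝ) 0 s₀) ∧
      (∀ y, ⟪(fderiv ℝ (v s₀) y) (curl (v s₀) y), (EuclideanSpace.single (2 : Fin 3) (1 : ℝ))⟫_ℝ = 0) :=
  ⟨omega3_slice_eq_zero_of_eqOn_open hrate hcont hmild hs₀ hO hne hzero,
    hasDerivAt_omega3_zero_of_poloidalSlice hrate hcont hmild hnn hs₀ hO hne hzero,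
    vertical_stretching_eq_zero_of_poloidalSlice hrate hcont hmild hdiv hnn hs₀ hO hne hzero⟩

end Summit.NavierStokesRegularity.NavierStokesRegularity.Theorems.AxisTwistDoorTiltDominationLocPoloidalSlice

end
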